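import Summits.CriticalPhenomena.PercolationContinuityZ3.Theorems.Transplant.SkelConcRealised
import Summits.CriticalPhenomena.PercolationContinuityZ3.Theorems.Transplant.PlanarCellsNarrowSep
import Summits.CriticalPhenomena.PercolationContinuityZ3.Theorems.Transplant.KNCells2Cover
import Summits.CriticalPhenomena.PercolationContinuityZ3.Theorems.Transplant.KNCells2RunInv
import HarnessLib

/-!
# L6 (C) over a planar skeleton: ALONG A RUN every explored vertex adjacent to the fresh corridor world `E_{v,x} ∪ H_{x,y}` of the chosen
# probe `(v → x)` is DEPTH-DEEP — `d_G(t, ·) ≤ E(nS α v)`, the radius of `v`'s own cube and stubs — generic twin of the product's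
# `BoxProdZ2.deep_of_run` (p223933), with the three planar separations DISCHARGED (hp-8's narrow probe world, `PlanarCellsNarrowSep`)

builds on p205010 (kernel theorem, internal audit signed; external expert review pending) — nothing in this file uses p205010.
Lane `prim-bschramm`, seat `prim-bschramm-p5` (gen 4; holder of the L6 (C) residue port, p3-g4 pick 19:36:29Z), helper file
(`--supports stmt-CriticalPhenomena-4575`).  Scheme of record `⟨Skel.cellGeomSG Φ C t Λ, q, δc⟩` (= stmt-g7's `SkelConc.concSchemeSG`, an
abbrev) with the schedule `Λ = Skel.concRadiiS C gap gap' E₀ L'` (p2-g3), root `t` in base position `Φ.φ t = 0`.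

**`Skel.deep_of_run`.**  For a history PRODUCED BY THE SCHEME (`hst₂ ω n`), the chosen edge `e = (v → x)` and an onward `du`: every `a ∈ Vx`
adjacent in `G` to a fresh vertex `b` of `Ewv(α)(v,x) ∪ Hfull(a')(x,du)` lies in `graphBall G t (E (nS α v))`.  Proof = the product's, over
spans: `a` lies in the root cube (depth `rQ 0 0 = max(E 0, off 0) ≤ E(nS α v)`), or in the new region of an earlier probe `e' = (w → u)`
(`RunInv₂.V_cases`); ON THE LINEAGE (`u = v`) that region has depth `rB = E(nQ α' u)`, `rQ α' u = E(nQ α' u)` (the max is inactive by the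
anchor-norm bound `Skel.l1_tgt_le_nQ` + p2's `concRadiiS_rQ_eq_of_norm_le`, under `20r ≤ gap`, `1 ≤ E₀`) or the stub profile `≤ E(nS β' u) − 2`,
and `E(nQ α' u) = E(nS β' u) = E(nS α v)` (`Realised.nS_eq`, `anchors_tgt_of_probe₂`); OFF THE LINEAGE the planar footprints are ℓ^∞-gap-2
separated (`Q_/BtwN_/Stub_sepInf_probeWorldN`, the four needed inequalities `u, w ∉ {x, y}` coming from `x`, `y` being undetermined while
`u`, `w` are determined), so `lip` forbids the edge.  This is the `hdeep`/entrance-depth input of the (C) rim excess.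
[cite: KozmaNitzan2024, §4 pp. 26–27 ((29), E_{i+1}), p. 31 (the corridor step)]
-/

noncomputable section

open scoped Classical

namespace Summit.CriticalPhenomena.PercolationContinuityZ3.Theorems

namespace Transplant

namespace Skel

open Literature.Probability.Percolation Literature.Probability.LatticeModels SimpleGraph GadgetSystem ProbeHistory HSiteScheme Contour
  KNCells PlanarSkeletonConc
open Literature.Probability.Percolation.KozmaNitzan.Cells (sgOf stepVec_apply_fst stepVec_apply_oth)
open Literature.Barriers.CriticalPhenomena (graphBall graphBall_mono mem_graphBall_self)
open BoxProdZ2 (Realised ConcRadiiG nQ nS gen0 Erad Frad Erad_mono PCells.cen_zero)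

variable {V : Type} [DecidableEq V] {G : SimpleGraph V} [G.LocallyFinite] (Φ : PlanarSkeletonConc G)

/-- **Residue (C), design (D) over a planar skeleton: explored neighbours of the fresh corridor world are depth-deep along a run** (see the
module docstring). [cite: KozmaNitzan2024, §4 pp. 26–27 ((29), E_{i+1}), p. 31] -/
theorem deep_of_run [Countable V] (C : PCells) (t : V) (gap gap' : ℕ → ℕ) (E₀ L' : ℕ) (q : unitInterval) (δc : ℝ)
    (hΛ : WFS C (concRadiiS C gap gap' E₀ L')) (hφ : Φ.φ t = 0) (hgap : ∀ n, 20 * C.r ≤ gap n) (hE₀ : 1 ≤ E₀)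
    (ω : BondConfig V) (n : ℕ) {e : Site 2 × MDir}
    (hc : (((⟨cellGeomSG Φ C t (concRadiiS C gap gap' E₀ L'), q, δc⟩ : KSchA V ℕ).scheme₂ G).stN n ω).choice = some e) {du : MDir}
    (hdu : du ∈ (⟨cellGeomSG Φ C t (concRadiiS C gap gap' E₀ L'), q, δc⟩ : KSchA V ℕ).onward G
      ((⟨cellGeomSG Φ C t (concRadiiS C gap gap' E₀ L'), q, δc⟩ : KSchA V ℕ).hst₂ G ω n) (tgt e)) (a' : ℕ) :
    ∀ a ∈ (⟨cellGeomSG Φ C t (concRadiiS C gap gap' E₀ L'), q, δc⟩ : KSchA V ℕ).Vx G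
        ((⟨cellGeomSG Φ C t (concRadiiS C gap gap' E₀ L'), q, δc⟩ : KSchA V ℕ).hst₂ G ω n),
      ∀ b ∈ (⟨cellGeomSG Φ C t (concRadiiS C gap gap' E₀ L'), q, δc⟩ : KSchA V ℕ).Γ.Ewv
          ((⟨cellGeomSG Φ C t (concRadiiS C gap gap' E₀ L'), q, δc⟩ : KSchA V ℕ).aOf₁ G
            ((⟨cellGeomSG Φ C t (concRadiiS C gap gap' E₀ L'), q, δc⟩ : KSchA V ℕ).hst₂ G ω n) e) e.1 e.2 ∪
        (faceDataSG Φ C t (concRadiiS C gap gap' E₀ L')).Hfull a' (tgt e) du,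
      b ∉ (⟨cellGeomSG Φ C t (concRadiiS C gap gap' E₀ L'), q, δc⟩ : KSchA V ℕ).Vx G
          ((⟨cellGeomSG Φ C t (concRadiiS C gap gap' E₀ L'), q, δc⟩ : KSchA V ℕ).hst₂ G ω n) →
      G.Adj a b →
      a ∈ graphBall G t (Erad gap gap' E₀ (nS ((⟨cellGeomSG Φ C t (concRadiiS C gap gap' E₀ L'), q, δc⟩ : KSchA V ℕ).aOf₁ G
        ((⟨cellGeomSG Φ C t (concRadiiS C gap gap' E₀ L'), q, δc⟩ : KSchA V ℕ).hst₂ G ω n) e) e.1)) := by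
  -- abbreviations
  set Λ := concRadiiS C gap gap' E₀ L' with hΛdef
  set S : KSchA V ℕ := ⟨cellGeomSG Φ C t Λ, q, δc⟩ with hSdef
  set h := S.hst₂ G ω n with hhdef
  set α := S.aOf₁ G h e with hαdef
  have hI : S.RunInv₂ G ω n := KSchA.runInv₂ (runGeomSG Φ C t) (anchGeomSG Φ C t) ω n
  have hsep : SepGeom G S.Γ := sepGeomSG Φ C t hΛ hφ
  set v := e.1 with hvdef
  set x := tgt e with hxdef
  set y := tgt e + stepVec du with hydef
  have hxv : x = v + stepVec e.2 := rfl
  -- `x` is undetermined, `y` has an unexplored column, `v` is occupied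
  have hcand := HState.cand_of_choice hc
  have hxndet : ¬((S.scheme₂ G).stN n ω).Det x := hcand.2
  have hcol : ∀ z ∈ S.Vx G h, z ∉ S.Γ.col y := fun z hz => (Finset.mem_filter.1 hdu).2 z hz
  have hyndet : ¬((S.scheme₂ G).stN n ω).Det y := by
    intro hdet
    obtain ⟨a₁, hQ⟩ := hI.det_Q y hdet
    obtain ⟨z, hz, hzc⟩ := hsep.col_Q a₁ y
    exact hcol z (hQ hz) hzc
  have hvdet : ((S.scheme₂ G).stN n ω).Det v := Or.inl hcand.1
  have hyv : v + stepVec e.2 + stepVec du ≠ v := fun hh =>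
    hyndet (by rw [show y = v + stepVec e.2 + stepVec du from rfl, hh]; exact hvdet)
  intro a ha b hb _ hadj
  -- planar footprint of `b`: the narrow probe world
  have hb2 : Φ.φ b ∈ C.probeWorldN v e.2 du := by
    rw [PCells.probeWorldN]
    rcases Finset.mem_union.1 hb with hb | hb
    · rw [CellGeom.Ewv] at hb
      rcases Finset.mem_union.1 hb with hb | hb
      · change b ∈ Φ.VWin t (C.BtwN v e.2) (Λ.rB α v e.2) at hb
        exact Finset.mem_union_left _ (Finset.mem_union_left _ (φ_mem_of_mem_VWin hb))
      · change b ∈ Φ.VWin t (C.Q (v + stepVec e.2)) (Λ.rQ α (v + stepVec e.2)) at hb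
        exact Finset.mem_union_left _ (Finset.mem_union_right _ (φ_mem_of_mem_VWin hb))
    · change b ∈ Φ.VStair t (C.Hfull (tgt e) du) (prof C Λ a' (tgt e) du) at hb
      exact Finset.mem_union_right _ (mem_of_mem_VStair hb).1
  rcases hI.V_cases a ha with haQ | ⟨m, hm, e', hc', hV', hD', ha'⟩
  · -- the root cube: depth `rQ 0 0 = max (E (nQ 0 0)) (off 0) ≤ E (nS α v)`
    change a ∈ Φ.VWin t (C.Q 0) (Λ.rQ 0 0) at haQ
    have ha1 : a ∈ graphBall G t (Λ.rQ 0 0) := mem_graphBall_of_mem_VWin haQ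
    refine graphBall_mono G t ?_ ha1
    change max (Erad gap gap' E₀ (nQ 0 0)) (off C 0) ≤ _
    refine max_le (Erad_mono gap gap' E₀ (by simp [nQ])) ?_
    have hoff : off C 0 = 1 := by simp [off]
    rw [hoff]
    exact hE₀.trans (E₀_le_Erad gap gap' E₀ _)
  · -- an earlier probe `e' = (w → u)`
    set h' := S.hst₂ G ω m with hh'def
    set α' := S.aOf₁ G h' e' with hα'def
    set β' := S.aOf₂ G h' e' with hβ'def
    set u := tgt e' with hudef
    have hc'' : (S.astOf₂ G h').st.choice = some e' := by rw [← S.stN_eq₂]; exact hc'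
    have hreal : Realised α' β' u := realised_of_choice_SG h' hc''
    have hnorm : (u 0).natAbs + (u 1).natAbs ≤ nQ α' u :=
      l1_tgt_le_nQ (cellGeomSG_anchor Φ C t Λ q δc) (cellGeomSG_a₀ Φ C t Λ q δc) h' hc''
    have hudet : ((S.scheme₂ G).stN n ω).Det u := KSchA.det_tgt_of_probe₂ hm hc' hD'
    have hwdet : ((S.scheme₂ G).stN n ω).Det e'.1 :=
      (S.scheme₂ G).det_stN_mono ω hm.le (Or.inl (HState.cand_of_choice hc').1)
    -- membership of `a` in the new region of `e'`
    have ha'' : a ∈ S.Γ.Ewv α' e'.1 e'.2 ∪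
        (S.onward G h' u).biUnion fun d => S.Γ.Stub β' u d (S.jOf G h' e' α' β' d (S.oOf₂ G ω h' e')) := ha'
    by_cases huv : u = v
    · -- THE LINEAGE: depth `E (nQ α' u) = E (nS β' u) = E (nS α v)`
      have harr : (S.astOf₂ G h).arr u = β' := (KSchA.anchors_tgt_of_probe₂ hm hc' hD').1
      have hαβ : α = β' := by
        rw [hαdef, KSchA.aOf₁]
        show (S.astOf₂ G h).arr v = β'
        rw [← huv]; exact harr
      have hE : Erad gap gap' E₀ (nQ α' u) = Erad gap gap' E₀ (nS α v) := by rw [hαβ, ← huv, hreal.nS_eq]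
      rcases Finset.mem_union.1 ha'' with ha3 | ha3
      · rw [CellGeom.Ewv] at ha3
        rcases Finset.mem_union.1 ha3 with ha3 | ha3
        · change a ∈ Φ.VWin t (C.BtwN e'.1 e'.2) (Λ.rB α' e'.1 e'.2) at ha3
          have ha1 : a ∈ graphBall G t (Λ.rB α' e'.1 e'.2) := mem_graphBall_of_mem_VWin ha3
          rw [← hE]
          exact ha1
        · change a ∈ Φ.VWin t (C.Q (e'.1 + stepVec e'.2)) (Λ.rQ α' (e'.1 + stepVec e'.2)) at ha3
          have ha1 : a ∈ graphBall G t (Λ.rQ α' (e'.1 + stepVec e'.2)) := mem_graphBall_of_mem_VWin ha3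
          rw [← hE, ← concRadiiS_rQ_eq_of_norm_le C gap gap' E₀ L' hgap hE₀ hnorm]
          exact ha1
      · obtain ⟨d, -, ha4⟩ := Finset.mem_biUnion.1 ha3
        change a ∈ Φ.VStair t (C.Stub u d _) (prof C Λ β' u d) at ha4
        have ha1 := (mem_of_mem_VStair ha4).2
        refine graphBall_mono G t ?_ ha1
        rw [hαβ, ← huv]
        exact (concRadiiS_ρ_le C gap gap' E₀ L' β' u d _).trans (Nat.sub_le _ _)
    · -- OFF THE LINEAGE: planar ℓ^∞-gap-2 separation forbids the edge (`lip`)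
      exfalso
      have hux : u ≠ v + stepVec e.2 := fun hh => hxndet (by rw [hxv, ← hh]; exact hudet)
      have huy : u ≠ v + stepVec e.2 + stepVec du := fun hh =>
        hyndet (by rw [show y = v + stepVec e.2 + stepVec du from rfl, ← hh]; exact hudet)
      have hwx : e'.1 ≠ v + stepVec e.2 := fun hh => hxndet (by rw [hxv, ← hh]; exact hwdet)
      have hwy : e'.1 ≠ v + stepVec e.2 + stepVec du := fun hh =>
        hyndet (by rw [show y = v + stepVec e.2 + stepVec du from rfl, ← hh]; exact hwdet)
      rcases Finset.mem_union.1 ha'' with ha3 | ha3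
      · rw [CellGeom.Ewv] at ha3
        rcases Finset.mem_union.1 ha3 with ha3 | ha3
        · change a ∈ Φ.VWin t (C.BtwN e'.1 e'.2) (Λ.rB α' e'.1 e'.2) at ha3
          have ha2 : Φ.φ a ∈ C.BtwN e'.1 e'.2 := φ_mem_of_mem_VWin ha3
          have hwv : e'.1 + stepVec e'.2 ≠ v := huv
          exact (Φ.toPlanarSkeleton.ne_not_adj_of_sepInf
            (C.BtwN_sepInf_probeWorldN v e.2 du e'.1 e'.2 hyv hwx hwy hwv hux huy) ha2 hb2).2 hadj
        · change a ∈ Φ.VWin t (C.Q (e'.1 + stepVec e'.2)) (Λ.rQ α' (e'.1 + stepVec e'.2)) at ha3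
          have ha2 : Φ.φ a ∈ C.Q u := φ_mem_of_mem_VWin ha3
          exact (Φ.toPlanarSkeleton.ne_not_adj_of_sepInf (C.Q_sepInf_probeWorldN v e.2 du u hyv huv hux huy) ha2 hb2).2 hadj
      · obtain ⟨d, -, ha4⟩ := Finset.mem_biUnion.1 ha3
        change a ∈ Φ.VStair t (C.Stub u d _) (prof C Λ β' u d) at ha4
        have ha2 := (mem_of_mem_VStair ha4).1
        have hj : S.jOf G h' e' α' β' d (S.oOf₂ G ω h' e') + 1 ≤ C.K := S.jOf_lt h' e' α' β' d _
        exact (Φ.toPlanarSkeleton.ne_not_adj_of_sepInf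
          (C.Stub_sepInf_probeWorldN v e.2 du u d _ hyv huv hux huy hj) ha2 hb2).2 hadj

end Skel

end Transplant

end Summit.CriticalPhenomena.PercolationContinuityZ3.Theorems

end
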